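import Summits.AtomisticToContinuum.Crystallization.Theorems.GappedShellCensusRadialDefectsVanishSplitRadius

/-!
# `GappedShellCensus.RadialDefectsVanish` (stmt-AtomisticToContinuum-15930), line `locally-twelve-gap`:
# the geometric stub empties the split child, at every locality radius; the cap lemma

Line `locally-twelve-gap` (crux-strategist s2, adopted by lead c2, 2026-08-17; skeleton `Cruxes/RadialDefectsVanish/Lines/
locally_twelve_gap.lean`): the crux modulo item stmt-AtomisticToContinuum-15808 (`TwelveWithinOne`), the Tammes-13 named fact, and
ONE own, ground-state-free, finite geometric stub `stub_locallyTwelveGap` — the k-centre `3.5 %`-tolerant Hales L12 gap: a site that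
is LOCALLY TWELVE out to radius `R` (every site within `R` has a `55/57`-separated `11/10`-neighbourhood and exactly twelve others within
distance `1`) has no other site at distance in the open annulus `(1, 21/17)`.  This file lands, def-free and with hypotheses stated
literally:

* `RdvLtg.gapBeyondTwelveAt_of_locallyTwelveGapAt` — for EVERY radius `R`, the geometric statement at radius `R` EMPTIES the bad set
  of the split child `GapBeyondTwelve` at radius `R` (verbatim the skeleton's `gapBeyondTwelve_of_locallyTwelveGap`, `7/2 ↦ R`); so the
  child holds for every `N`, with no ground-state hypothesis and no `θ`;
* `radialDefectsVanish_of_locallyTwelveGapAt` — the crux from the Tammes-13 named fact, `TwelveWithinOne` and the geometric statement at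
  ANY radius `R ≥ 0`, through the landed radius-free glue `radialDefectsVanish_of_tammes_at` (p136971); and the registered composition
  `radialDefectsVanish_of_locallyTwelveGap` (`R = 7/2`, the stub as registered).  A certificate at a SMALLER hypothesis radius is a
  STRONGER geometric statement and closes the crux just the same (use the `At` form) — the lead's probes (kit j021710, j022622–4) say the
  certificate needs the annulus site to be locally twelve too (hypothesis radius `≥ 21/17`: miss `≈ 9 %` at `55/57`), while the
  shell-only two-centre form (radius `1`) has a margin of only `≈ 3 %` and fails at tolerance `0.935`;
* `RdvLtg.inner_le_of_annulus` — the CAP LEMMA H1 of the line card: an annulus point `z` (`1 ≤ ‖z‖ ≤ 21/17`) and a shell point `v`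
  (`55/57 ≤ ‖v‖ ≤ 1`) at distance `≥ 55/57` satisfy `⟪z, v⟫ ≤ 0.6456·‖z‖·‖v‖` (angle `≥ 49.79°`): the twelve shell directions of a
  locally-twelve site avoid a spherical cap of that radius around the direction of any annulus neighbour (the bound
  `(r² + t² − s²)/(2rt)` is convex on the box and maximal, `0.64555`, at `r = 21/17`, `t = 1`).
-/

noncomputable section

open scoped BigOperators Topology Classical RealInnerProductSpace
open Filter Finset
open Literature.MathematicalPhysics.StatisticalMechanics
open Literature.Geometry.DiscreteGeometry (musinTarasov2012_tammes_thirteen)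

namespace Summit.AtomisticToContinuum.Crystallization.Theorems

namespace RdvLtg

/-- **The geometric statement at radius `R` empties the bad set of the split child at radius `R`** (verbatim the skeleton's
`gapBeyondTwelve_of_locallyTwelveGap` of `Lines/locally_twelve_gap.lean`, crux-strategist s2, with `7/2 ↦ R`): for every
configuration and every `N` the set of radius-`R` locally-twelve sites with an annulus neighbour is EMPTY, so its cardinality is
`0 ≤ θ·N`; no ground-state hypothesis and no `θ` enter. [folklore] -/
theorem gapBeyondTwelveAt_of_locallyTwelveGapAt (R : ℝ)
    (hLTG : ∀ (N : ℕ) (X : Fin N → EuclideanSpace ℝ (Fin 3)) (i : Fin N),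
      (∀ j : Fin N, dist (X i) (X j) ≤ R →
        (∀ k : Fin N, dist (X j) (X k) ≤ 11 / 10 → ∀ l : Fin N, l ≠ k → (55 : ℝ) / 57 ≤ dist (X k) (X l)) ∧
        (Finset.univ.filter fun k : Fin N => k ≠ j ∧ dist (X j) (X k) ≤ 1).card = 12) →
      ∀ j : Fin N, j ≠ i → dist (X i) (X j) ≤ 1 ∨ (21 : ℝ) / 17 ≤ dist (X i) (X j)) :
    ∀ x : (N : ℕ) → (Fin N → EuclideanSpace ℝ (Fin 3)),
      (∀ N, Literature.MathematicalPhysics.StatisticalMechanics.IsGroundState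
        Literature.MathematicalPhysics.StatisticalMechanics.lennardJones (x N)) →
      ∀ θ : ℝ, 0 < θ → ∃ᶠ N in Filter.atTop, (Nat.card {i : Fin N //
        (∀ j : Fin N, dist (x N i) (x N j) ≤ R →
          (∀ k : Fin N, dist (x N j) (x N k) ≤ 11 / 10 → ∀ l : Fin N, l ≠ k → (55 : ℝ) / 57 ≤ dist (x N k) (x N l)) ∧
          (Finset.univ.filter fun k : Fin N => k ≠ j ∧ dist (x N j) (x N k) ≤ 1).card = 12) ∧
        ∃ j : Fin N, j ≠ i ∧ 1 < dist (x N i) (x N j) ∧ dist (x N i) (x N j) < 21 / 17} : ℝ) ≤ θ * N := by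
  intro x _hx θ hθ
  refine Filter.Eventually.frequently (Filter.Eventually.of_forall fun N => ?_)
  have hEmpty : IsEmpty {i : Fin N //
      (∀ j : Fin N, dist (x N i) (x N j) ≤ R →
        (∀ k : Fin N, dist (x N j) (x N k) ≤ 11 / 10 → ∀ l : Fin N, l ≠ k → (55 : ℝ) / 57 ≤ dist (x N k) (x N l)) ∧
        (Finset.univ.filter fun k : Fin N => k ≠ j ∧ dist (x N j) (x N k) ≤ 1).card = 12) ∧
      ∃ j : Fin N, j ≠ i ∧ 1 < dist (x N i) (x N j) ∧ dist (x N i) (x N j) < 21 / 17} := by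
    refine ⟨fun ⟨i, hLT, j, hji, h1, h2⟩ => ?_⟩
    rcases hLTG N (x N) i hLT j hji with h | h
    · exact absurd h1 (not_lt.2 h)
    · exact absurd h2 (not_lt.2 h)
  have hcard : Nat.card {i : Fin N //
      (∀ j : Fin N, dist (x N i) (x N j) ≤ R →
        (∀ k : Fin N, dist (x N j) (x N k) ≤ 11 / 10 → ∀ l : Fin N, l ≠ k → (55 : ℝ) / 57 ≤ dist (x N k) (x N l)) ∧
        (Finset.univ.filter fun k : Fin N => k ≠ j ∧ dist (x N j) (x N k) ≤ 1).card = 12) ∧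
      ∃ j : Fin N, j ≠ i ∧ 1 < dist (x N i) (x N j) ∧ dist (x N i) (x N j) < 21 / 17} = 0 :=
    Nat.card_of_isEmpty
  rw [hcard]
  push_cast
  positivity

/-- **Cap lemma (H1 of the line card).**  If `1 ≤ ‖z‖ ≤ 21/17`, `55/57 ≤ ‖v‖ ≤ 1` and `dist z v ≥ 55/57`, then
`⟪z, v⟫ ≤ 0.6456 · ‖z‖ · ‖v‖`, i.e. the angle between an annulus neighbour and a shell neighbour of a locally-twelve site is at least
`arccos 0.6456 ≈ 49.79°`: `2⟪z,v⟫ = ‖z‖² + ‖v‖² − ‖z − v‖² ≤ r² + t² − s²`, and `r² + t² − s² ≤ 1.2912·r·t` on the box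
`[1, 21/17] × [55/57, 1]` (convex in `(r, t)`, so it suffices at the four corners; the binding corner is `r = 21/17`, `t = 1`:
`1.59490 ≤ 1.59493`). [folklore] -/
theorem inner_le_of_annulus {z v : EuclideanSpace ℝ (Fin 3)} (hz1 : 1 ≤ ‖z‖) (hz2 : ‖z‖ ≤ 21 / 17)
    (hv1 : (55 : ℝ) / 57 ≤ ‖v‖) (hv2 : ‖v‖ ≤ 1) (hzv : (55 : ℝ) / 57 ≤ dist z v) :
    ⟪z, v⟫ ≤ 6456 / 10000 * (‖z‖ * ‖v‖) := by
  have hinner : ⟪z, v⟫ = (‖z‖ ^ 2 + ‖v‖ ^ 2 - ‖z - v‖ ^ 2) / 2 := by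
    rw [norm_sub_sq_real]; ring
  have hd : ((55 : ℝ) / 57) ^ 2 ≤ ‖z - v‖ ^ 2 := by
    rw [← dist_eq_norm]
    exact pow_le_pow_left₀ (by norm_num) hzv 2
  rw [hinner]
  nlinarith [mul_nonneg (sub_nonneg.2 hz1) (sub_nonneg.2 hz2), mul_nonneg (sub_nonneg.2 hv1) (sub_nonneg.2 hv2),
    mul_nonneg (sub_nonneg.2 hz1) (sub_nonneg.2 hv1), mul_nonneg (sub_nonneg.2 hz1) (sub_nonneg.2 hv2),
    mul_nonneg (sub_nonneg.2 hz2) (sub_nonneg.2 hv1), mul_nonneg (sub_nonneg.2 hz2) (sub_nonneg.2 hv2)]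

/-- Cap lemma, normalised form: the unit vectors along `z` and `v` have inner product `≤ 0.6456` (cf.
`TwelveWithinOne.Negative.inner_normalized_le` for the shell–shell bound `≤ 1 − (55/57)²/2 = 0.5345`). [folklore] -/
theorem inner_normalized_le_of_annulus {z v : EuclideanSpace ℝ (Fin 3)} (hz1 : 1 ≤ ‖z‖) (hz2 : ‖z‖ ≤ 21 / 17)
    (hv1 : (55 : ℝ) / 57 ≤ ‖v‖) (hv2 : ‖v‖ ≤ 1) (hzv : (55 : ℝ) / 57 ≤ dist z v) :
    ⟪‖z‖⁻¹ • z, ‖v‖⁻¹ • v⟫ ≤ 6456 / 10000 := by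
  have hz0 : 0 < ‖z‖ := by linarith
  have hv0 : 0 < ‖v‖ := by linarith
  have key := inner_le_of_annulus hz1 hz2 hv1 hv2 hzv
  rw [real_inner_smul_left, real_inner_smul_right, ← mul_assoc, ← mul_inv, inv_mul_le_iff₀ (by positivity)]
  linarith [key]

end RdvLtg

open RdvLtg in
/-- **The crux from the Tammes-13 named fact, `TwelveWithinOne` and the geometric statement at ANY locality radius `R ≥ 0`**,
through the landed radius-free glue `radialDefectsVanish_of_tammes_at` (p136971).  A certificate for the geometric statement at a
smaller radius is a stronger statement and may be plugged in here directly. [cite: MusinTarasov2012, Theorem 1] -/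
theorem radialDefectsVanish_of_locallyTwelveGapAt {R : ℝ} (hR : 0 ≤ R) (hMT : musinTarasov2012_tammes_thirteen)
    (hK2 : ∀ x : (N : ℕ) → (Fin N → EuclideanSpace ℝ (Fin 3)),
      (∀ N, Literature.MathematicalPhysics.StatisticalMechanics.IsGroundState
        Literature.MathematicalPhysics.StatisticalMechanics.lennardJones (x N)) →
      Filter.Tendsto (fun N : ℕ => (Nat.card {i : Fin N // ¬ ((∀ j : Fin N, dist (x N i) (x N j) ≤ 11 / 10 →
        ∀ k : Fin N, k ≠ j → (55 : ℝ) / 57 ≤ dist (x N j) (x N k)) ∧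
        12 ≤ (Finset.univ.filter fun j : Fin N => j ≠ i ∧ dist (x N i) (x N j) ≤ 1).card)} : ℝ) / N)
        Filter.atTop (nhds 0))
    (hLTG : ∀ (N : ℕ) (X : Fin N → EuclideanSpace ℝ (Fin 3)) (i : Fin N),
      (∀ j : Fin N, dist (X i) (X j) ≤ R →
        (∀ k : Fin N, dist (X j) (X k) ≤ 11 / 10 → ∀ l : Fin N, l ≠ k → (55 : ℝ) / 57 ≤ dist (X k) (X l)) ∧
        (Finset.univ.filter fun k : Fin N => k ≠ j ∧ dist (X j) (X k) ≤ 1).card = 12) →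
      ∀ j : Fin N, j ≠ i → dist (X i) (X j) ≤ 1 ∨ (21 : ℝ) / 17 ≤ dist (X i) (X j)) :
    Summit.AtomisticToContinuum.Crystallization.Theses.GappedShellCensus.RadialDefectsVanish :=
  radialDefectsVanish_of_tammes_at hR hMT hK2 (gapBeyondTwelveAt_of_locallyTwelveGapAt R hLTG)

open RdvLtg in
/-- **Registered composition of line `locally-twelve-gap`** (`R = 7/2`, the own stub `stub_locallyTwelveGap` as registered on
stmt-AtomisticToContinuum-15930): Tammes-13 fact → `TwelveWithinOne` (item 15808) → `LocallyTwelveGap` → `RadialDefectsVanish`.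
[cite: MusinTarasov2012, Theorem 1] -/
theorem radialDefectsVanish_of_locallyTwelveGap (hMT : musinTarasov2012_tammes_thirteen)
    (hK2 : ∀ x : (N : ℕ) → (Fin N → EuclideanSpace ℝ (Fin 3)),
      (∀ N, Literature.MathematicalPhysics.StatisticalMechanics.IsGroundState
        Literature.MathematicalPhysics.StatisticalMechanics.lennardJones (x N)) →
      Filter.Tendsto (fun N : ℕ => (Nat.card {i : Fin N // ¬ ((∀ j : Fin N, dist (x N i) (x N j) ≤ 11 / 10 →
        ∀ k : Fin N, k ≠ j → (55 : ℝ) / 57 ≤ dist (x N j) (x N k)) ∧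
        12 ≤ (Finset.univ.filter fun j : Fin N => j ≠ i ∧ dist (x N i) (x N j) ≤ 1).card)} : ℝ) / N)
        Filter.atTop (nhds 0))
    (hLTG : ∀ (N : ℕ) (X : Fin N → EuclideanSpace ℝ (Fin 3)) (i : Fin N),
      (∀ j : Fin N, dist (X i) (X j) ≤ 7 / 2 →
        (∀ k : Fin N, dist (X j) (X k) ≤ 11 / 10 → ∀ l : Fin N, l ≠ k → (55 : ℝ) / 57 ≤ dist (X k) (X l)) ∧
        (Finset.univ.filter fun k : Fin N => k ≠ j ∧ dist (X j) (X k) ≤ 1).card = 12) →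
      ∀ j : Fin N, j ≠ i → dist (X i) (X j) ≤ 1 ∨ (21 : ℝ) / 17 ≤ dist (X i) (X j)) :
    Summit.AtomisticToContinuum.Crystallization.Theses.GappedShellCensus.RadialDefectsVanish :=
  radialDefectsVanish_of_locallyTwelveGapAt (by norm_num : (0 : ℝ) ≤ 7 / 2) hMT hK2 hLTG

end Summit.AtomisticToContinuum.Crystallization.Theorems

end
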